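import Mathlib
import Literature.NumberTheory.Irrationality.DirichletLValues.LinearIndependence
import HarnessLib

/-!
# Fischler 2020, Corollary 2 (Hurwitz zeta values at a positive rational) DERIVED from Theorem 4

Topic `Literature/NumberTheory/Irrationality/DirichletLValues`. Proofs-only companion of
`LinearIndependence.lean` (S. Fischler, *Irrationality of values of `L`-functions of Dirichlet characters*,
J. London Math. Soc. (2) **101** (2020) 857–876 = arXiv:1904.02402 [Fischler2020LValues]; held text
`paper:arxiv-1904.02402`, §1 pp. 2–3). That file types Theorem 4 (label (th3)) as the named fact
`fischler2020_theorem4`, PROVES Theorem 2 (`fischler2020_theorem2`) and Corollary 1 (`fischler2020_corollary1`)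
from it, and leaves **Corollary 2** — the same count for the HURWITZ zeta values `ζ(s,r)`, `r ∈ ℚ_{>0}` — as
the separate named fact `fischler2020_corollary2`. This file proves the printed implication

* `fischler2020_corollary2_of_theorem4 : fischler2020_theorem4 → fischler2020_corollary2`,

so that all three printed consequences of Theorem 4 are now derived from it in the tree (Corollary 2 itself stays
conditional on Theorem 4; no named fact is discharged, none is introduced).

## The printed route

[Fischler2020LValues, §1 p. 2, display]: "Given `u ∈ {1,…,T−1}` we define `f` by `f(n) = 1` if `n ≡ u mod T`, and
`f(n) = 0` otherwise. Then `L(f,s) = Σ_{k≥0} 1/(kT+u)^s = T^{−s} Σ_{k≥0} 1/(k+u/T)^s = T^{−s} ζ(s,u/T)`", and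
p. 3: Corollaries 1 and 2 are "the two main special cases of Theorem 2".  For a general positive rational
`r = u/v` (`u, v ≥ 1`; `r ≥ 1` allowed, as in the statement of Corollary 2) the indicator `f = 1_{n ≡ u (v)}` is
`v`-periodic and not identically zero (`isPeriodicNonzero_progression`), and
`L(f,s) = v^{−s} ζ(s,r) + c_s` with the RATIONAL correction `c_s = Σ_{1 ≤ n < u, n ≡ u (v)} n^{−s}` (the finitely
many terms of the progression below `u`; `c_s = 0` when `u ≤ v`) — `periodicL_progression_eq`.  Hence
`ζ(s,r) ∈ E` forces `L(f,s) ∈ E′ := E + ℚ·1` (`periodicL_progression_mem_sup`), a finite-dimensional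
`ℚ`-subspace independent of `s`, and Theorem 2 for `(f, E′)` bounds
`#{2 ≤ s ≤ a, s ≡ p (2) : ζ(s,r) ∉ E} ≥ #{… : L(f,s) ∉ E′} ≥ 2^{(1−ε) log a/log log a}`.

Lean: the `L`-series is Mathlib's `LSeries` (`periodicL`); its term function is split into the part on
`{n ≥ u}`, re-indexed along `m ↦ u + mv` (`Function.Injective.hasSum_iff`) onto the real Hurwitz series
`hurwitzValue s (u/v) = Σ_{m≥0} (m + u/v)^{−s}` of `LinearIndependence.lean` (cast by `Complex.hasSum_ofReal`),
and the finitely supported part on `{n < u}` (`hasSum_sum_of_ne_finset_zero`).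

HONEST FRAMING (cell zeta5-irr / pub-zeta5): a printed special case made a kernel implication; nothing here
concerns `ζ(5)`; no record moves; Theorem 4 itself remains a named fact.
-/

noncomputable section

open Filter Finset

namespace Literature.NumberTheory.Irrationality.DirichletLValues

/-! ### The indicator of the progression `n ≡ u (mod v)` -/

/-- The indicator `f = 1_{n ≡ u (mod v)}` on `ℤ` is `v`-periodic and not identically zero (`f(u) = 1`), i.e. it
satisfies the standing hypotheses of [Fischler2020LValues] (`IsPeriodicNonzero`).
[cite: Fischler2020LValues, §1 p. 2 (the example `f(n) = 1` if `n ≡ u mod T`)] -/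
theorem isPeriodicNonzero_progression (u : ℤ) (v : ℕ) :
    IsPeriodicNonzero v (fun n : ℤ => if (v : ℤ) ∣ n - u then (1 : ℂ) else 0) := by
  refine ⟨fun n => ?_, ⟨u, by simp⟩⟩
  have h : (v : ℤ) ∣ n + v - u ↔ (v : ℤ) ∣ n - u := by
    rw [show n + (v : ℤ) - u = (n - u) + v by ring, dvd_add_left (dvd_refl _)]
  simp only [h]

/-- Summability of the real Hurwitz series `Σ_{m ≥ 0} (m + x)^{−s}` for `x > 0`, `s ≥ 2`. [folklore] -/
private theorem summable_one_div_nat_add_pow {x : ℝ} (hx : 0 < x) {s : ℕ} (hs : 2 ≤ s) :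
    Summable (fun m : ℕ => 1 / ((m : ℝ) + x) ^ s) := by
  have h := (Real.summable_one_div_nat_add_rpow x s).2 (by exact_mod_cast hs)
  refine h.congr fun n => ?_
  rw [abs_of_pos (by positivity), Real.rpow_natCast]

/-- `Σ_{m ≥ 0} (u + mv)^{−s} = v^{−s} ζ(s, u/v)` for `u, v ≥ 1`, `s ≥ 2`, with the tree's real Hurwitz value
`hurwitzValue s x = Σ_{m ≥ 0} (m + x)^{−s}` — the display "`Σ_k 1/(kT+u)^s = T^{−s} ζ(s,u/T)`".
[cite: Fischler2020LValues, §1 p. 2 (display)] -/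
theorem hasSum_progression_hurwitzValue {u v s : ℕ} (hu : 1 ≤ u) (hv : 1 ≤ v) (hs : 2 ≤ s) :
    HasSum (fun m : ℕ => 1 / (((u + m * v : ℕ) : ℝ)) ^ s)
      (1 / (v : ℝ) ^ s * hurwitzValue s ((u : ℝ) / v)) := by
  have hu0 : (0 : ℝ) < u := by exact_mod_cast hu
  have hv0 : (0 : ℝ) < v := by exact_mod_cast hv
  have hx : (0 : ℝ) < (u : ℝ) / v := div_pos hu0 hv0
  have hS := ((summable_one_div_nat_add_pow hx hs).hasSum).mul_left (1 / (v : ℝ) ^ s)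
  rw [hurwitzValue]
  refine hS.congr_fun fun m => ?_
  have hv1 : (v : ℝ) ≠ 0 := hv0.ne'
  have e : ((u + m * v : ℕ) : ℝ) = (v : ℝ) * ((m : ℝ) + (u : ℝ) / v) := by
    push_cast
    field_simp
    ring
  rw [e, mul_pow, one_div_mul_one_div]

/-- **`L(f,s) = v^{−s} ζ(s, u/v) + c_s`** for the indicator `f = 1_{n ≡ u (v)}` (`u, v ≥ 1`, `s ≥ 2`), with the
rational correction `c_s = Σ_{n < u, n ≡ u (v)} n^{−s}` collecting the terms of the progression below `u`
(Mathlib's convention `1/0 = 0` makes the `n = 0` summand vanish, as the `L`-series omits it).  For `u < v`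
this is the printed `L(f,s) = v^{−s} ζ(s,u/v)`. [cite: Fischler2020LValues, §1 p. 2 (display)] -/
theorem periodicL_progression_eq {u v s : ℕ} (hu : 1 ≤ u) (hv : 1 ≤ v) (hs : 2 ≤ s) :
    periodicL (fun n : ℤ => if (v : ℤ) ∣ n - u then (1 : ℂ) else 0) s =
      (1 / (v : ℂ) ^ s) * ((hurwitzValue s ((u : ℝ) / v) : ℝ) : ℂ) +
        ∑ n ∈ Finset.range u, (if (v : ℤ) ∣ (n : ℤ) - u then 1 / (n : ℂ) ^ s else 0) := by
  set f : ℤ → ℂ := fun n => if (v : ℤ) ∣ n - u then (1 : ℂ) else 0 with hf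
  set g : ℕ → ℂ := LSeries.term (fun n : ℕ => f n) s with hg
  -- the term function, explicitly
  have hg_eval : ∀ n : ℕ, g n = if n ≠ 0 ∧ (v : ℤ) ∣ (n : ℤ) - u then 1 / (n : ℂ) ^ s else 0 := by
    intro n
    rcases eq_or_ne n 0 with rfl | hn
    · simp [hg, LSeries.term_zero]
    · rw [hg, LSeries.term_of_ne_zero hn, hf]
      simp only [Complex.cpow_natCast, ne_eq, hn, not_false_eq_true, true_and]
      split_ifs <;> simp
  -- split `g` into the progression part (`n ≥ u`) and the finite part (`n < u`)
  set g₁ : ℕ → ℂ := fun n => if u ≤ n then g n else 0 with hg₁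
  set g₂ : ℕ → ℂ := fun n => if n < u then g n else 0 with hg₂
  have hsplit : g = fun n => g₁ n + g₂ n := by
    funext n
    simp only [hg₁, hg₂]
    split_ifs with h₁ h₂ h₂
    · omega
    · simp
    · simp
    · omega
  -- the finite part
  have h2 : HasSum g₂ (∑ n ∈ Finset.range u, (if (v : ℤ) ∣ (n : ℤ) - u then 1 / (n : ℂ) ^ s else 0)) := by
    have hz : ∀ n ∉ Finset.range u, g₂ n = 0 := by
      intro n hn
      rw [Finset.mem_range, not_lt] at hn
      simp [hg₂, not_lt.2 hn]
    have h : HasSum g₂ (∑ n ∈ Finset.range u, g₂ n) := hasSum_sum_of_ne_finset_zero hz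
    have hsum : ∑ n ∈ Finset.range u, g₂ n =
        ∑ n ∈ Finset.range u, (if (v : ℤ) ∣ (n : ℤ) - u then 1 / (n : ℂ) ^ s else 0) := by
      refine Finset.sum_congr rfl fun n hn => ?_
      rw [Finset.mem_range] at hn
      simp only [hg₂, if_pos hn, hg_eval n]
      rcases eq_or_ne n 0 with rfl | hn0
      · simp [zero_pow (by omega : s ≠ 0)]
      · simp [hn0]
    rwa [hsum] at h
  -- the progression part, re-indexed along `m ↦ u + m v`
  have h1 : HasSum g₁ ((1 / (v : ℂ) ^ s) * ((hurwitzValue s ((u : ℝ) / v) : ℝ) : ℂ)) := by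
    have hinj : Function.Injective (fun m : ℕ => u + m * v) := by
      intro m m' h
      have h' : m * v = m' * v := by simpa using h
      exact Nat.eq_of_mul_eq_mul_right (by omega) h'
    have hsupp : ∀ n, n ∉ Set.range (fun m : ℕ => u + m * v) → g₁ n = 0 := by
      intro n hn
      simp only [hg₁]
      split_ifs with hun
      · rw [hg_eval]
        split_ifs with hc
        · exfalso
          apply hn
          obtain ⟨-, k, hk⟩ := hc
          have hk0 : 0 ≤ k := by
            have h0 : (0 : ℤ) ≤ (v : ℤ) * k := by rw [← hk]; omega
            exact nonneg_of_mul_nonneg_right h0 (by exact_mod_cast hv)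
          refine ⟨k.toNat, ?_⟩
          have : ((u + k.toNat * v : ℕ) : ℤ) = n := by
            push_cast
            rw [Int.toNat_of_nonneg hk0]
            linarith
          exact_mod_cast this
        · rfl
      · rfl
    rw [← hinj.hasSum_iff hsupp]
    have hcomp : (g₁ ∘ fun m : ℕ => u + m * v) =
        fun m : ℕ => (((1 / (((u + m * v : ℕ) : ℝ)) ^ s : ℝ)) : ℂ) := by
      funext m
      simp only [Function.comp_apply, hg₁, if_pos (Nat.le_add_right u (m * v))]
      rw [hg_eval, if_pos ⟨by omega, ⟨(m : ℤ), by push_cast; ring⟩⟩]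
      push_cast
      rfl
    rw [hcomp]
    have hR := Complex.hasSum_ofReal.2 (hasSum_progression_hurwitzValue hu hv hs)
    convert hR using 1
    push_cast
    rfl
  -- assemble
  have hsum := h1.add h2
  rw [periodicL, LSeries, show (LSeries.term (fun n : ℕ => f n) s) = g from rfl, hsplit]
  exact hsum.tsum_eq

/-- If `ζ(s, u/v) ∈ E` (a `ℚ`-subspace of `ℂ`), then `L(1_{n ≡ u (v)}, s) ∈ E + ℚ·1`: the scalar `v^{−s}` and the
correction `c_s` are rational. [cite: Fischler2020LValues, §1 p. 2 (display) and p. 3 ("special cases of Theorem 2")] -/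
theorem periodicL_progression_mem_sup {u v s : ℕ} (hu : 1 ≤ u) (hv : 1 ≤ v) (hs : 2 ≤ s)
    (E : Submodule ℚ ℂ) (hE : ((hurwitzValue s ((u : ℝ) / v) : ℝ) : ℂ) ∈ E) :
    periodicL (fun n : ℤ => if (v : ℤ) ∣ n - u then (1 : ℂ) else 0) s ∈
      E ⊔ Submodule.span ℚ {(1 : ℂ)} := by
  rw [periodicL_progression_eq hu hv hs]
  refine Submodule.add_mem_sup ?_ ?_
  · have e : (1 / (v : ℂ) ^ s) * ((hurwitzValue s ((u : ℝ) / v) : ℝ) : ℂ) =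
        ((1 / (v : ℚ) ^ s : ℚ)) • ((hurwitzValue s ((u : ℝ) / v) : ℝ) : ℂ) := by
      rw [Rat.smul_def]
      push_cast
      rfl
    rw [e]
    exact E.smul_mem _ hE
  · refine Submodule.sum_mem _ fun n _ => ?_
    split_ifs
    · have e : (1 / (n : ℂ) ^ s) = ((1 / (n : ℚ) ^ s : ℚ)) • (1 : ℂ) := by
        rw [Rat.smul_def, mul_one]
        push_cast
        rfl
      rw [e]
      exact Submodule.smul_mem _ _ (Submodule.subset_span rfl)
    · exact Submodule.zero_mem _

/-! ### Corollary 2 from Theorem 4 -/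

/-- **Fischler 2020, Corollary 2, DERIVED from Theorem 4** (via Theorem 2, `fischler2020_theorem2`): for a positive
rational `r`, `p ∈ {0,1}`, a finite-dimensional `ℚ`-subspace `E ⊂ ℂ` and `ε > 0`, for all sufficiently large `a`
at least `2^{(1−ε) log a/log log a}` of the Hurwitz values `ζ(s,r)`, `2 ≤ s ≤ a`, `s ≡ p (2)`, lie outside `E`.
Route: `r = u/v`, `f = 1_{n ≡ u (v)}`, `E′ = E + ℚ·1`; `ζ(s,r) ∈ E ⇒ L(f,s) ∈ E′`
(`periodicL_progression_mem_sup`), so Theorem 2 for `(f, E′)` gives the count.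
[cite: Fischler2020LValues, §1 Corollary 2 and p. 3 ("the two main special cases of Theorem 2"); §3.2 Theorem 4] -/
theorem fischler2020_corollary2_of_theorem4 (h4 : fischler2020_theorem4) : fischler2020_corollary2 := by
  intro r hr p hp E hE ε hε
  -- `r = u / v` with positive integers `u, v`
  obtain ⟨u, v, hu, hv, huv⟩ : ∃ u v : ℕ, 1 ≤ u ∧ 1 ≤ v ∧ (r : ℝ) = (u : ℝ) / v := by
    have hnum : 0 < r.num := Rat.num_pos.mpr hr
    refine ⟨r.num.toNat, r.den, by omega, r.den_pos, ?_⟩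
    have hn : ((r.num.toNat : ℕ) : ℤ) = r.num := Int.toNat_of_nonneg hnum.le
    rw [Rat.cast_def]
    congr 1
    exact_mod_cast hn.symm
  haveI : FiniteDimensional ℚ E := hE
  haveI : FiniteDimensional ℚ (Submodule.span ℚ ({(1 : ℂ)} : Set ℂ)) :=
    FiniteDimensional.span_of_finite ℚ (Set.finite_singleton _)
  have h2 := fischler2020_theorem2 h4 hv (isPeriodicNonzero_progression (u : ℤ) v) hp
    (E ⊔ Submodule.span ℚ {(1 : ℂ)}) hε
  filter_upwards [h2] with a ha
  refine ha.trans ?_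
  have hsub : {s : ℕ | 2 ≤ s ∧ s ≤ a ∧ s % 2 = p ∧
        periodicL (fun n : ℤ => if (v : ℤ) ∣ n - u then (1 : ℂ) else 0) s ∉
          E ⊔ Submodule.span ℚ {(1 : ℂ)}} ⊆
      {s : ℕ | 2 ≤ s ∧ s ≤ a ∧ s % 2 = p ∧ ((hurwitzValue s r : ℝ) : ℂ) ∉ E} := by
    rintro s ⟨h2s, hsa, hsp, hnot⟩
    refine ⟨h2s, hsa, hsp, fun hmem => hnot ?_⟩
    rw [huv] at hmem
    exact periodicL_progression_mem_sup hu hv h2s E hmem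
  have hfin : ({s : ℕ | 2 ≤ s ∧ s ≤ a ∧ s % 2 = p ∧ ((hurwitzValue s r : ℝ) : ℂ) ∉ E}).Finite :=
    (Set.finite_Iic a).subset fun s hs => hs.2.1
  unfold outsideCount
  exact_mod_cast Set.ncard_le_ncard hsub hfin

end Literature.NumberTheory.Irrationality.DirichletLValues

end
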